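import Summits.QuantumFields.QCD.Theorems.HeatSlicedQuarksQuarkLoopCoefficientSecondOrderExpansionAuxI

/-!
# Second-order expansion of the heat symbol — part J: vertices on profile-bounded fields, the forcings
(line `Sketch` of crux stmt-QuantumFields-16786, stub `stub_secondOrderExpansion`, helper file)

* Generic bounds: for a field with entries `≤ B Γ_c(s, ·)`, the order-`j` vertex costs `(1+s)ᵏ` (`j ≤ 2k`)
  and the cocycle remainder `V_θ f − Σ_{j<m} θʲ vtx j f` costs `|θ|ᵐ (1+s)ᵏ` (`m ≤ 2k`), with profile `c/4`.
* The second-order forcing `q₂ = V_θ(E₀ + θE₁) − vtx0 E₀ − θ(vtx0 E₁ + vtx1 E₀) = W₂E₀ + θW₁E₁` of the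
  remainder `R₂ = E_θ − E₀ − θE₁`, its leading parts `F = vtx2 E₀ + vtx1 E₁`, `q₃' = vtx3 E₀ + vtx2 E₁`, and
  the tail `q̃ = q₂ − θ²F − θ³q₃' = W₄E₀ + θW₃E₁`: algebraic identities and profile bounds
  `‖F‖ ≤ K(1+s)Γ`, `‖q₃'‖ ≤ K(1+s)²Γ`, `‖q₂‖ ≤ K(θ²(1+s) + |θ|³(1+s)²)Γ`, `‖q̃‖ ≤ Kθ⁴((1+s)² + (1+s)³)Γ`.
-/

noncomputable section

namespace Summit.QuantumFields.QCD.Cruxes.QuarkLoopCoefficient.Sketch.SecondOrderExpansion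

open Literature.MathematicalPhysics.QuantumLattice Literature.MathematicalPhysics.QuantumFieldTheory
open Literature.Probability.LatticeModels (Site)
open Summit.QuantumFields.QCD.Theorems.QuarkLoopCoefficient
open Summit.QuantumFields.QCD.Cruxes.QuarkLoopCoefficient.Sketch.HeatSeries
open Summit.QuantumFields.QCD.Cruxes.QuarkLoopCoefficient.Sketch.FreeMajorantToolkit
open Summit.QuantumFields.QCD.Cruxes.QuarkLoopCoefficient.Sketch.SymmetricGauge
open scoped Matrix ComplexConjugate

/-- The twisted generator `(V_θ f)(w) = Σ_{v ∈ nbr2 0} Ω_θ(v, w) • (ȟ_θ(v) f(w − v))` (local notation). -/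
local notation "V[" θ "]" => (fun (f : Site 4 → Spin) (w : Site 4) =>
  ∑ v ∈ nbr2 0, Complex.exp (((θ / 2 * (wedge v w : ℤ) : ℝ) : ℂ) * Complex.I) • (sqKer (symLink θ) 0 v * f (w - v)))

/-! ## §21 Vertices and cocycle remainders on profile-bounded fields -/

/-- **Generic vertex bound**: `‖(vtx j f w)_{γδ}‖ ≤ K B (1+s)ᵏ Γ_{c/4}(s,w)` if `‖f(y)_{γδ}‖ ≤ B Γ_c(s,y)`
(`j ≤ 2k`). -/
theorem exists_norm_vtx_apply_le_of_profile
    (hT3 : ∀ c ε : ℝ, 0 < c → 0 < ε → ε < 1 → ∀ j : ℕ, ∃ A : ℝ, ∀ t : ℝ, 0 ≤ t → ∀ w : Site 4,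
      elen w ^ j * gaussProfile c t w ≤ A * Real.sqrt (1 + t) ^ j * gaussProfile ((1 - ε) * c) t w)
    (hT4 : ∀ c ε : ℝ, 0 < c → 0 < ε → ε < 1 → ∃ A : ℝ, ∀ t : ℝ, 0 ≤ t → ∀ w z : Site 4, elen z ≤ 2 →
      gaussProfile c t (w + z) ≤ A * gaussProfile ((1 - ε) * c) t w)
    {c : ℝ} (hc : 0 < c) {j k : ℕ} (hjk : j ≤ 2 * k) :
    ∃ K : ℝ, 0 ≤ K ∧ ∀ s : ℝ, 0 ≤ s → ∀ B : ℝ, 0 ≤ B → ∀ f : Site 4 → Spin,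
      (∀ (y : Site 4) (γ δ : Fin 4), ‖f y γ δ‖ ≤ B * gaussProfile c s y) →
      ∀ (w : Site 4) (γ δ : Fin 4), ‖vtx j f w γ δ‖ ≤ K * B * (1 + s) ^ k * gaussProfile (c / 4) s w := by
  obtain ⟨A, hA0, hA⟩ := exists_sum_nbr2_gaussProfile_le hT4 hc
  obtain ⟨A', hA0', hA'⟩ := exists_weight_gaussProfile_le hT3 (half_pos hc) hjk
  have hc4 : c / 2 / 2 = c / 4 := by ring
  rw [hc4] at hA'
  refine ⟨20736 * 2 ^ j * A * A', by positivity, fun s hs B hB f hf w γ δ => ?_⟩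
  have he := elen_nonneg w
  have h1 := norm_vtx_apply_le (F := fun y => B * gaussProfile c s y) hf j w γ δ
  refine h1.trans ?_
  have hsum : ∑ v ∈ nbr2 0, B * gaussProfile c s (w - v) ≤ B * (A * gaussProfile (c / 2) s w) := by
    rw [← Finset.mul_sum]; exact mul_le_mul_of_nonneg_left (hA s hs w) hB
  calc 20736 * (2 * (1 + elen w)) ^ j * ∑ v ∈ nbr2 0, B * gaussProfile c s (w - v)
      ≤ 20736 * (2 * (1 + elen w)) ^ j * (B * (A * gaussProfile (c / 2) s w)) := by gcongr
    _ = 20736 * 2 ^ j * B * A * ((1 + elen w) ^ j * gaussProfile (c / 2) s w) := by rw [mul_pow]; ring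
    _ ≤ 20736 * 2 ^ j * B * A * (A' * (1 + s) ^ k * gaussProfile (c / 4) s w) :=
        mul_le_mul_of_nonneg_left (hA' s hs w) (by positivity)
    _ = _ := by ring

/-- **Generic cocycle remainder bound**:
`‖(V_θ f − Σ_{j<m} θʲ vtx j f)(w)_{γδ}‖ ≤ K |θ|ᵐ B (1+s)ᵏ Γ_{c/4}(s,w)` if `‖f(y)_{γδ}‖ ≤ B Γ_c(s,y)` (`m ≤ 2k`). -/
theorem exists_norm_twistedRem_apply_le_of_profile
    (hT3 : ∀ c ε : ℝ, 0 < c → 0 < ε → ε < 1 → ∀ j : ℕ, ∃ A : ℝ, ∀ t : ℝ, 0 ≤ t → ∀ w : Site 4,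
      elen w ^ j * gaussProfile c t w ≤ A * Real.sqrt (1 + t) ^ j * gaussProfile ((1 - ε) * c) t w)
    (hT4 : ∀ c ε : ℝ, 0 < c → 0 < ε → ε < 1 → ∃ A : ℝ, ∀ t : ℝ, 0 ≤ t → ∀ w z : Site 4, elen z ≤ 2 →
      gaussProfile c t (w + z) ≤ A * gaussProfile ((1 - ε) * c) t w)
    {c : ℝ} (hc : 0 < c) {m k : ℕ} (hmk : m ≤ 2 * k) :
    ∃ K : ℝ, 0 ≤ K ∧ ∀ θ : ℝ, ∀ s : ℝ, 0 ≤ s → ∀ B : ℝ, 0 ≤ B → ∀ f : Site 4 → Spin,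
      (∀ (y : Site 4) (γ δ : Fin 4), ‖f y γ δ‖ ≤ B * gaussProfile c s y) →
      ∀ (w : Site 4) (γ δ : Fin 4),
        ‖(V[θ] f w - ∑ j ∈ Finset.range m, (θ : ℂ) ^ j • vtx j f w) γ δ‖ ≤
          K * |θ| ^ m * B * (1 + s) ^ k * gaussProfile (c / 4) s w := by
  obtain ⟨A, hA0, hA⟩ := exists_sum_nbr2_gaussProfile_le hT4 hc
  obtain ⟨A', hA0', hA'⟩ := exists_weight_gaussProfile_le hT3 (half_pos hc) hmk
  have hc4 : c / 2 / 2 = c / 4 := by ring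
  rw [hc4] at hA'
  refine ⟨20736 * 2 ^ m * A * A', by positivity, fun θ s hs B hB f hf w γ δ => ?_⟩
  have he := elen_nonneg w
  have h1 := norm_twistedGen_sub_sum_vtx_apply_le θ (F := fun y => B * gaussProfile c s y) hf m w γ δ
  refine h1.trans ?_
  have hsum : ∑ v ∈ nbr2 0, B * gaussProfile c s (w - v) ≤ B * (A * gaussProfile (c / 2) s w) := by
    rw [← Finset.mul_sum]; exact mul_le_mul_of_nonneg_left (hA s hs w) hB
  calc 20736 * (2 * |θ| * (1 + elen w)) ^ m * ∑ v ∈ nbr2 0, B * gaussProfile c s (w - v)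
      ≤ 20736 * (2 * |θ| * (1 + elen w)) ^ m * (B * (A * gaussProfile (c / 2) s w)) := by gcongr
    _ = 20736 * 2 ^ m * |θ| ^ m * B * A * ((1 + elen w) ^ m * gaussProfile (c / 2) s w) := by
        rw [mul_pow, mul_pow]; ring
    _ ≤ 20736 * 2 ^ m * |θ| ^ m * B * A * (A' * (1 + s) ^ k * gaussProfile (c / 4) s w) :=
        mul_le_mul_of_nonneg_left (hA' s hs w) (by positivity)
    _ = _ := by ring

/-! ## §22 The forcings of the second-order remainder: algebra -/

/-- `q₂ = W₂E₀ + θ W₁E₁`: the forcing of `R₂ = E_θ − E₀ − θE₁` in cocycle-remainder form. -/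
theorem forcing₂_eq (θ s : ℝ) (w : Site 4) :
    V[θ] (pert0 s) w + (θ : ℂ) • V[θ] (pert1 s) w - vtx 0 (pert0 s) w -
        (θ : ℂ) • (vtx 0 (pert1 s) w + vtx 1 (pert0 s) w) =
      (V[θ] (pert0 s) w - ∑ j ∈ Finset.range 2, (θ : ℂ) ^ j • vtx j (pert0 s) w) +
        (θ : ℂ) • (V[θ] (pert1 s) w - ∑ j ∈ Finset.range 1, (θ : ℂ) ^ j • vtx j (pert1 s) w) := by
  simp only [Finset.sum_range_succ, Finset.sum_range_zero, zero_add, pow_zero, one_smul, pow_one, smul_add,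
    smul_sub]
  abel

/-- `q̃ = q₂ − θ²F − θ³q₃' = W₄E₀ + θ W₃E₁`: the tail of the forcing beyond third order. -/
theorem forcingTail_eq (θ s : ℝ) (w : Site 4) :
    V[θ] (pert0 s) w + (θ : ℂ) • V[θ] (pert1 s) w - vtx 0 (pert0 s) w -
        (θ : ℂ) • (vtx 0 (pert1 s) w + vtx 1 (pert0 s) w) -
        (θ : ℂ) ^ 2 • (vtx 2 (pert0 s) w + vtx 1 (pert1 s) w) -
        (θ : ℂ) ^ 3 • (vtx 3 (pert0 s) w + vtx 2 (pert1 s) w) =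
      (V[θ] (pert0 s) w - ∑ j ∈ Finset.range 4, (θ : ℂ) ^ j • vtx j (pert0 s) w) +
        (θ : ℂ) • (V[θ] (pert1 s) w - ∑ j ∈ Finset.range 3, (θ : ℂ) ^ j • vtx j (pert1 s) w) := by
  simp only [Finset.sum_range_succ, Finset.sum_range_zero, zero_add, pow_zero, one_smul, pow_one, smul_add,
    smul_sub, smul_smul]
  module

/-! ## §23 The forcings: profile bounds -/

/-- **Bounds of the forcings.**  Given the free-kernel majorant with constants `C_k`, `c`, there are `K`
and the profile constant `c/8` such that for all `θ` and `s ≥ 0`: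
`‖F‖ ≤ K(1+s)Γ`, `‖q₃'‖ ≤ K(1+s)²Γ`, `‖q₂‖ ≤ K(θ²(1+s) + |θ|³(1+s)²)Γ`, `‖q̃‖ ≤ K θ⁴((1+s)² + (1+s)³)Γ`. -/
theorem exists_forcing_bounds {Ck ck : ℝ} (hck : 0 < ck)
    (hk : ∀ t : ℝ, 0 ≤ t → ∀ w : Site 4, |freeKer t w| ≤ Ck * gaussProfile ck t w)
    (hT3 : ∀ c ε : ℝ, 0 < c → 0 < ε → ε < 1 → ∀ j : ℕ, ∃ A : ℝ, ∀ t : ℝ, 0 ≤ t → ∀ w : Site 4,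
      elen w ^ j * gaussProfile c t w ≤ A * Real.sqrt (1 + t) ^ j * gaussProfile ((1 - ε) * c) t w)
    (hT4 : ∀ c ε : ℝ, 0 < c → 0 < ε → ε < 1 → ∃ A : ℝ, ∀ t : ℝ, 0 ≤ t → ∀ w z : Site 4, elen z ≤ 2 →
      gaussProfile c t (w + z) ≤ A * gaussProfile ((1 - ε) * c) t w)
    (h1 : ∀ x y : Site 4, sqKer (fun _ => (1 : ℂ)) x y = ((hhat (y - x) : ℝ) : ℂ) • (1 : Spin))
    (h3 : ∀ w : Site 4, freeKer 0 w = if w = 0 then 1 else 0)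
    (h5 : ∀ s r : ℝ, 0 ≤ s → 0 ≤ r → ∀ w : Site 4,
      HasSum (fun y : Site 4 => freeKer s y * freeKer r (w - y)) (freeKer (s + r) w))
    (h6 : ∀ t : ℝ, 0 ≤ t → ∀ (w : Site 4) (ν : Fin 4),
      t * (∑ z ∈ nbr2 0, ((z ν : ℤ) : ℝ) * hhat z * freeKer t (w - z)) + ((w ν : ℤ) : ℝ) * freeKer t w = 0) :
    ∃ K : ℝ, 0 ≤ K ∧ ∀ θ : ℝ, ∀ s : ℝ, 0 ≤ s → ∀ (w : Site 4) (γ δ : Fin 4),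
      ‖(vtx 2 (pert0 s) w + vtx 1 (pert1 s) w) γ δ‖ ≤ K * (1 + s) * gaussProfile (ck / 8) s w ∧
      ‖(vtx 3 (pert0 s) w + vtx 2 (pert1 s) w) γ δ‖ ≤ K * (1 + s) ^ 2 * gaussProfile (ck / 8) s w ∧
      ‖(V[θ] (pert0 s) w + (θ : ℂ) • V[θ] (pert1 s) w - vtx 0 (pert0 s) w -
          (θ : ℂ) • (vtx 0 (pert1 s) w + vtx 1 (pert0 s) w)) γ δ‖ ≤
        K * (θ ^ 2 * (1 + s) + |θ| ^ 3 * (1 + s) ^ 2) * gaussProfile (ck / 8) s w ∧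
      ‖(V[θ] (pert0 s) w + (θ : ℂ) • V[θ] (pert1 s) w - vtx 0 (pert0 s) w -
          (θ : ℂ) • (vtx 0 (pert1 s) w + vtx 1 (pert0 s) w) -
          (θ : ℂ) ^ 2 • (vtx 2 (pert0 s) w + vtx 1 (pert1 s) w) -
          (θ : ℂ) ^ 3 • (vtx 3 (pert0 s) w + vtx 2 (pert1 s) w)) γ δ‖ ≤
        K * θ ^ 4 * ((1 + s) ^ 2 + (1 + s) ^ 3) * gaussProfile (ck / 8) s w := by
  have hCk : 0 ≤ Ck := by
    have := hk 0 le_rfl 0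
    have h0 : 0 < gaussProfile ck 0 0 := by rw [gaussProfile_zero_right]; norm_num
    nlinarith [abs_nonneg (freeKer 0 0)]
  have hck2 : 0 < ck / 2 := half_pos hck
  -- the inputs: E₀ ≤ Ck Γ_c, E₁ ≤ C₁ (1+s) Γ_{c/2}, vtx1 E₁ ≤ Cv (1+s) Γ_{c/4}
  obtain ⟨C₁, hC₁0, hE₁⟩ := exists_norm_pert1_apply_le hck hk hT4 h1 h3 h5 h6
  obtain ⟨Cv, hCv0, hV₁⟩ := exists_norm_vtx_one_pert1_apply_le hck hk hT4 h1 h3 h5 h6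
  -- generic constants: vertices of order 2, 3 on E₀ (profile c → c/4) and of order 2 on E₁ (c/2 → c/8),
  -- cocycle remainders of order 2, 4 on E₀ and of order 1, 3 on E₁
  obtain ⟨K2, hK20, hK2⟩ := exists_norm_vtx_apply_le_of_profile hT3 hT4 hck (j := 2) (k := 1) (by norm_num)
  obtain ⟨K3, hK30, hK3⟩ := exists_norm_vtx_apply_le_of_profile hT3 hT4 hck (j := 3) (k := 2) (by norm_num)
  obtain ⟨K2', hK2'0, hK2'⟩ := exists_norm_vtx_apply_le_of_profile hT3 hT4 hck2 (j := 2) (k := 1) (by norm_num)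
  obtain ⟨W2, hW20, hW2⟩ := exists_norm_twistedRem_apply_le_of_profile hT3 hT4 hck (m := 2) (k := 1) (by norm_num)
  obtain ⟨W4, hW40, hW4⟩ := exists_norm_twistedRem_apply_le_of_profile hT3 hT4 hck (m := 4) (k := 2) (by norm_num)
  obtain ⟨W2', hW2'0, hW2'⟩ :=
    exists_norm_twistedRem_apply_le_of_profile hT3 hT4 hck2 (m := 2) (k := 1) (by norm_num)
  obtain ⟨W3', hW3'0, hW3'⟩ :=
    exists_norm_twistedRem_apply_le_of_profile hT3 hT4 hck2 (m := 3) (k := 2) (by norm_num)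
  have e4 : ck / 2 / 4 = ck / 8 := by ring
  rw [e4] at hK2' hW2' hW3'
  -- profile monotonicity `Γ_{c/4} ≤ Γ_{c/8}`
  have hmono : ∀ s : ℝ, 0 ≤ s → ∀ w : Site 4, gaussProfile (ck / 4) s w ≤ gaussProfile (ck / 8) s w :=
    fun s hs w => gaussProfile_anti (by linarith) hs w
  -- one constant dominating all pieces
  set Ktot : ℝ := K2 * Ck + Cv + K3 * Ck + K2' * C₁ + W2 * Ck + W2' * C₁ + W4 * Ck + W3' * C₁ with hKtot
  have n1 := mul_nonneg hK20 hCk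
  have n2 := mul_nonneg hK30 hCk
  have n3 := mul_nonneg hK2'0 hC₁0
  have n4 := mul_nonneg hW20 hCk
  have n5 := mul_nonneg hW2'0 hC₁0
  have n6 := mul_nonneg hW40 hCk
  have n7 := mul_nonneg hW3'0 hC₁0
  have hKtot0 : 0 ≤ Ktot := by rw [hKtot]; positivity
  refine ⟨Ktot, hKtot0, fun θ s hs w γ δ => ?_⟩
  have hs1 : (1 : ℝ) ≤ 1 + s := by linarith
  have hs0 : (0 : ℝ) ≤ 1 + s := by linarith
  have hΓ := gaussProfile_nonneg (ck / 8) s w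
  -- the individual pieces
  have hE₀ : ∀ (y : Site 4) (γ δ : Fin 4), ‖pert0 s y γ δ‖ ≤ Ck * gaussProfile ck s y :=
    fun y γ δ => norm_pert0_apply_le hk hs y γ δ
  have hE₁' : ∀ (y : Site 4) (γ δ : Fin 4), ‖pert1 s y γ δ‖ ≤ C₁ * (1 + s) * gaussProfile (ck / 2) s y :=
    fun y γ δ => hE₁ s hs y γ δ
  have p2 : ‖vtx 2 (pert0 s) w γ δ‖ ≤ K2 * Ck * (1 + s) * gaussProfile (ck / 8) s w := by
    have := hK2 s hs Ck hCk _ hE₀ w γ δ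
    rw [pow_one] at this
    exact this.trans (mul_le_mul_of_nonneg_left (hmono s hs w) (by positivity))
  have p3 : ‖vtx 3 (pert0 s) w γ δ‖ ≤ K3 * Ck * (1 + s) ^ 2 * gaussProfile (ck / 8) s w :=
    (hK3 s hs Ck hCk _ hE₀ w γ δ).trans (mul_le_mul_of_nonneg_left (hmono s hs w) (by positivity))
  have p2' : ‖vtx 2 (pert1 s) w γ δ‖ ≤ K2' * (C₁ * (1 + s)) * (1 + s) * gaussProfile (ck / 8) s w := by
    have := hK2' s hs (C₁ * (1 + s)) (by positivity) _ hE₁' w γ δ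
    rwa [pow_one] at this
  have pv : ‖vtx 1 (pert1 s) w γ δ‖ ≤ Cv * (1 + s) * gaussProfile (ck / 8) s w :=
    (hV₁ s hs w γ δ).trans (mul_le_mul_of_nonneg_left (hmono s hs w) (by positivity))
  have w2 : ‖(V[θ] (pert0 s) w - ∑ j ∈ Finset.range 2, (θ : ℂ) ^ j • vtx j (pert0 s) w) γ δ‖ ≤
      W2 * |θ| ^ 2 * Ck * (1 + s) * gaussProfile (ck / 8) s w := by
    have := hW2 θ s hs Ck hCk _ hE₀ w γ δ
    rw [pow_one] at this
    exact this.trans (mul_le_mul_of_nonneg_left (hmono s hs w) (by positivity))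
  have w4 : ‖(V[θ] (pert0 s) w - ∑ j ∈ Finset.range 4, (θ : ℂ) ^ j • vtx j (pert0 s) w) γ δ‖ ≤
      W4 * |θ| ^ 4 * Ck * (1 + s) ^ 2 * gaussProfile (ck / 8) s w :=
    (hW4 θ s hs Ck hCk _ hE₀ w γ δ).trans (mul_le_mul_of_nonneg_left (hmono s hs w) (by positivity))
  have w2' : ‖(V[θ] (pert1 s) w - ∑ j ∈ Finset.range 2, (θ : ℂ) ^ j • vtx j (pert1 s) w) γ δ‖ ≤
      W2' * |θ| ^ 2 * (C₁ * (1 + s)) * (1 + s) * gaussProfile (ck / 8) s w := by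
    have := hW2' θ s hs (C₁ * (1 + s)) (by positivity) _ hE₁' w γ δ
    rwa [pow_one (1 + s)] at this
  have w3' : ‖(V[θ] (pert1 s) w - ∑ j ∈ Finset.range 3, (θ : ℂ) ^ j • vtx j (pert1 s) w) γ δ‖ ≤
      W3' * |θ| ^ 3 * (C₁ * (1 + s)) * (1 + s) ^ 2 * gaussProfile (ck / 8) s w :=
    hW3' θ s hs (C₁ * (1 + s)) (by positivity) _ hE₁' w γ δ
  have hθ := abs_nonneg θ
  have hθ2 : θ ^ 2 = |θ| ^ 2 := (sq_abs θ).symm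
  have hθ4 : θ ^ 4 = |θ| ^ 4 := (Even.pow_abs (by decide) θ).symm
  refine ⟨?_, ?_, ?_, ?_⟩
  · -- `F = vtx2 E₀ + vtx1 E₁`
    rw [Matrix.add_apply]
    refine (norm_add_le _ _).trans ((add_le_add p2 pv).trans ?_)
    have hle : K2 * Ck + Cv ≤ Ktot := by rw [hKtot]; linarith
    calc K2 * Ck * (1 + s) * gaussProfile (ck / 8) s w + Cv * (1 + s) * gaussProfile (ck / 8) s w
        = (K2 * Ck + Cv) * ((1 + s) * gaussProfile (ck / 8) s w) := by ring
      _ ≤ Ktot * ((1 + s) * gaussProfile (ck / 8) s w) := mul_le_mul_of_nonneg_right hle (by positivity)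
      _ = _ := by ring
  · -- `q₃' = vtx3 E₀ + vtx2 E₁`
    rw [Matrix.add_apply]
    refine (norm_add_le _ _).trans ((add_le_add p3 p2').trans ?_)
    have hle : K3 * Ck + K2' * C₁ ≤ Ktot := by rw [hKtot]; linarith
    calc K3 * Ck * (1 + s) ^ 2 * gaussProfile (ck / 8) s w +
          K2' * (C₁ * (1 + s)) * (1 + s) * gaussProfile (ck / 8) s w
        = (K3 * Ck + K2' * C₁) * ((1 + s) ^ 2 * gaussProfile (ck / 8) s w) := by ring
      _ ≤ Ktot * ((1 + s) ^ 2 * gaussProfile (ck / 8) s w) := mul_le_mul_of_nonneg_right hle (by positivity)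
      _ = _ := by ring
  · -- `q₂ = W₂E₀ + θ W₁E₁`, with `W₁E₁ = θ • vtx1 E₁ + W₂E₁`
    rw [forcing₂_eq, Matrix.add_apply]
    refine (norm_add_le _ _).trans ?_
    have hsec : ‖((θ : ℂ) • (V[θ] (pert1 s) w - ∑ j ∈ Finset.range 1, (θ : ℂ) ^ j • vtx j (pert1 s) w)) γ δ‖ ≤
        |θ| * (|θ| * (Cv * (1 + s) * gaussProfile (ck / 8) s w) +
          W2' * |θ| ^ 2 * (C₁ * (1 + s)) * (1 + s) * gaussProfile (ck / 8) s w) := by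
      rw [Matrix.smul_apply, smul_eq_mul, norm_mul, Complex.norm_real, Real.norm_eq_abs]
      refine mul_le_mul_of_nonneg_left ?_ hθ
      have hsplit : V[θ] (pert1 s) w - ∑ j ∈ Finset.range 1, (θ : ℂ) ^ j • vtx j (pert1 s) w =
          (θ : ℂ) • vtx 1 (pert1 s) w +
            (V[θ] (pert1 s) w - ∑ j ∈ Finset.range 2, (θ : ℂ) ^ j • vtx j (pert1 s) w) := by
        simp only [Finset.sum_range_succ, Finset.sum_range_zero, zero_add, pow_zero, one_smul, pow_one]
        abel
      rw [hsplit, Matrix.add_apply]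
      refine (norm_add_le _ _).trans (add_le_add ?_ w2')
      rw [Matrix.smul_apply, smul_eq_mul, norm_mul, Complex.norm_real, Real.norm_eq_abs]
      exact mul_le_mul_of_nonneg_left pv hθ
    refine (add_le_add w2 hsec).trans ?_
    have ha : 0 ≤ |θ| ^ 2 * (1 + s) * gaussProfile (ck / 8) s w := by positivity
    have hb : 0 ≤ |θ| ^ 3 * (1 + s) ^ 2 * gaussProfile (ck / 8) s w := by positivity
    have hle1 : W2 * Ck + Cv ≤ Ktot := by rw [hKtot]; linarith
    have hle2 : W2' * C₁ ≤ Ktot := by rw [hKtot]; linarith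
    have m1 := mul_le_mul_of_nonneg_right hle1 ha
    have m2 := mul_le_mul_of_nonneg_right hle2 hb
    rw [hθ2]
    have e : W2 * |θ| ^ 2 * Ck * (1 + s) * gaussProfile (ck / 8) s w +
        |θ| * (|θ| * (Cv * (1 + s) * gaussProfile (ck / 8) s w) +
          W2' * |θ| ^ 2 * (C₁ * (1 + s)) * (1 + s) * gaussProfile (ck / 8) s w) =
        (W2 * Ck + Cv) * (|θ| ^ 2 * (1 + s) * gaussProfile (ck / 8) s w) +
          W2' * C₁ * (|θ| ^ 3 * (1 + s) ^ 2 * gaussProfile (ck / 8) s w) := by ring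
    rw [e]
    have e2 : Ktot * (|θ| ^ 2 * (1 + s) + |θ| ^ 3 * (1 + s) ^ 2) * gaussProfile (ck / 8) s w =
        Ktot * (|θ| ^ 2 * (1 + s) * gaussProfile (ck / 8) s w) +
          Ktot * (|θ| ^ 3 * (1 + s) ^ 2 * gaussProfile (ck / 8) s w) := by ring
    rw [e2]
    exact add_le_add m1 m2
  · -- `q̃ = W₄E₀ + θ W₃E₁`
    rw [forcingTail_eq, Matrix.add_apply]
    refine (norm_add_le _ _).trans ?_
    have hsec : ‖((θ : ℂ) • (V[θ] (pert1 s) w - ∑ j ∈ Finset.range 3, (θ : ℂ) ^ j • vtx j (pert1 s) w)) γ δ‖ ≤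
        |θ| * (W3' * |θ| ^ 3 * (C₁ * (1 + s)) * (1 + s) ^ 2 * gaussProfile (ck / 8) s w) := by
      rw [Matrix.smul_apply, smul_eq_mul, norm_mul, Complex.norm_real, Real.norm_eq_abs]
      exact mul_le_mul_of_nonneg_left w3' hθ
    refine (add_le_add w4 hsec).trans ?_
    have ha : 0 ≤ |θ| ^ 4 * (1 + s) ^ 2 * gaussProfile (ck / 8) s w := by positivity
    have hb : 0 ≤ |θ| ^ 4 * (1 + s) ^ 3 * gaussProfile (ck / 8) s w := by positivity
    have hle1 : W4 * Ck ≤ Ktot := by rw [hKtot]; linarith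
    have hle2 : W3' * C₁ ≤ Ktot := by rw [hKtot]; linarith
    have m1 := mul_le_mul_of_nonneg_right hle1 ha
    have m2 := mul_le_mul_of_nonneg_right hle2 hb
    rw [hθ4]
    have e : W4 * |θ| ^ 4 * Ck * (1 + s) ^ 2 * gaussProfile (ck / 8) s w +
        |θ| * (W3' * |θ| ^ 3 * (C₁ * (1 + s)) * (1 + s) ^ 2 * gaussProfile (ck / 8) s w) =
        W4 * Ck * (|θ| ^ 4 * (1 + s) ^ 2 * gaussProfile (ck / 8) s w) +
          W3' * C₁ * (|θ| ^ 4 * (1 + s) ^ 3 * gaussProfile (ck / 8) s w) := by ring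
    rw [e]
    have e2 : Ktot * |θ| ^ 4 * ((1 + s) ^ 2 + (1 + s) ^ 3) * gaussProfile (ck / 8) s w =
        Ktot * (|θ| ^ 4 * (1 + s) ^ 2 * gaussProfile (ck / 8) s w) +
          Ktot * (|θ| ^ 4 * (1 + s) ^ 3 * gaussProfile (ck / 8) s w) := by ring
    rw [e2]
    exact add_le_add m1 m2

/-! ## Registered headline -/

/-- Registered headline of this helper file (aux stub `stub_secondOrderExpansionAuxJ` of crux
stmt-QuantumFields-16786, line `Sketch`): the algebraic form `q₂ = W₂E₀ + θ W₁E₁` of the second-order forcing. -/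
theorem stub_secondOrderExpansionAuxJ : ∀ (θ s : ℝ) (w : Site 4), (∑ v ∈ nbr2 0, Complex.exp (((θ / 2 * (wedge v w : ℤ) : ℝ) : ℂ) * Complex.I) • (sqKer (symLink θ) 0 v * pert0 s (w - v))) + (θ : ℂ) • (∑ v ∈ nbr2 0, Complex.exp (((θ / 2 * (wedge v w : ℤ) : ℝ) : ℂ) * Complex.I) • (sqKer (symLink θ) 0 v * pert1 s (w - v))) - vtx 0 (pert0 s) w - (θ : ℂ) • (vtx 0 (pert1 s) w + vtx 1 (pert0 s) w) = ((∑ v ∈ nbr2 0, Complex.exp (((θ / 2 * (wedge v w : ℤ) : ℝ) : ℂ) * Complex.I) • (sqKer (symLink θ) 0 v * pert0 s (w - v))) - ∑ j ∈ Finset.range 2, (θ : ℂ) ^ j • vtx j (pert0 s) w) + (θ : ℂ) • ((∑ v ∈ nbr2 0, Complex.exp (((θ / 2 * (wedge v w : ℤ) : ℝ) : ℂ) * Complex.I) • (sqKer (symLink θ) 0 v * pert1 s (w - v))) - ∑ j ∈ Finset.range 1, (θ : ℂ) ^ j • vtx j (pert1 s) w) :=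
  fun θ s w => forcing₂_eq θ s w

end Summit.QuantumFields.QCD.Cruxes.QuarkLoopCoefficient.Sketch.SecondOrderExpansion

end
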